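import Summits.CriticalPhenomena.CardyFormulaZ2.Theorems.CardyBoundaryCoulombGasBoundaryDefectGaussianRStubTransportPathsPart27

/-!
# Stub `stub_transportPaths` of line `rainbow-monomials-in-excursion-kernels` — Part 33:
# last bookkeeping for the assembly: processing order, mark–corner clearance, the anchor chart
# (crux `CardyBoundaryCoulombGas.BoundaryDefectGaussianR`, stmt-CriticalPhenomena-14132)

* `tp_order_ccw`, `tp_order_cw`, `tp_order_mem` — the processing order (clockwise movers by
  increasing index, then counterclockwise movers by decreasing index): which points are already
  at their slots when a given mover moves;
* `tp_mark_corner_dist` — a uniform clearance `dmc > 0` of the marks from the corners of their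
  edges;
* `tp_anchor_chart` — the first conclusion of TRANSPORT: near the anchor `a_n` the lattice domain
  is the discrete upper half-plane (`tp_rail_point` on the bottom edge `zA`).
All [folklore].
-/

noncomputable section

open Set Filter Metric Topology Literature.Probability.RandomPlanarGeometry
open Literature.Probability.LatticeModels Literature.Probability.LatticeModels.CollarLegModel
open Summit.CriticalPhenomena.CardyFormulaZ2.Cruxes.RectilinearCardy.ExcursionKernelCovariance

namespace Summit.CriticalPhenomena.CardyFormulaZ2.Cruxes.BoundaryDefectGaussianR.RainbowMonomialsInExcursionKernels

/-! ### The processing order -/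

/-- Every index occurs in the processing order. [folklore] -/
theorem tp_order_mem {k : ℕ} (mark : Fin k → ℝ) (α : ℝ) (hαm : ∀ i, mark i ≠ α) (i : Fin k) :
    i ∈ (List.finRange k).filter (fun i => decide (α < mark i)) ++
      ((List.finRange k).filter (fun i => decide (mark i < α))).reverse := by
  rcases lt_or_gt_of_ne (hαm i) with h | h
  · exact List.mem_append_right _ (List.mem_reverse.2 (List.mem_filter.2 ⟨List.mem_finRange i,
      by simpa using h⟩))
  · exact List.mem_append_left _ (List.mem_filter.2 ⟨List.mem_finRange i, by simpa using h⟩)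

/-- **Counterclockwise movers**: when `m` (`mark m < α`) moves, exactly the points `i' > m` are
already at their slots. [folklore] -/
theorem tp_order_ccw {k : ℕ} (mark : Fin k → ℝ) (hsm : StrictMono mark) (α : ℝ)
    (hαm : ∀ i, mark i ≠ α) {m : Fin k} (hm : mark m < α) {pre post : List (Fin k)}
    (h : (List.finRange k).filter (fun i => decide (α < mark i)) ++
      ((List.finRange k).filter (fun i => decide (mark i < α))).reverse = pre ++ m :: post) :
    m ∉ pre ∧ ∀ i', i' ≠ m → (i' ∈ pre ↔ m < i') := by
  have hm1 : m ∉ (List.finRange k).filter (fun i => decide (α < mark i)) := by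
    intro hmem; have := (List.mem_filter.1 hmem).2; simp at this; linarith
  obtain ⟨pre₂, hpre, hl₂⟩ := tp_split_notMem_left hm1 h
  have hsorted : ((List.finRange k).filter (fun i => decide (mark i < α))).reverse.Pairwise (· > ·) := by
    rw [List.pairwise_reverse]
    exact (List.pairwise_lt_finRange k).filter _
  have key := tp_pre_gt hsorted hl₂
  refine ⟨fun hmem => ?_, fun i' hi' => ?_⟩
  · rw [hpre] at hmem
    rcases List.mem_append.1 hmem with h1 | h1
    · exact hm1 h1
    · exact lt_irrefl _ ((key m).1 h1).2
  · rw [hpre, List.mem_append, key i']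
    constructor
    · rintro (h1 | ⟨-, h1⟩)
      · have := (List.mem_filter.1 h1).2
        simp at this
        exact hsm.lt_iff_lt.1 (hm.trans this)
      · exact h1
    · intro hlt
      rcases lt_or_gt_of_ne (hαm i') with h1 | h1
      · exact Or.inr ⟨List.mem_reverse.2 (List.mem_filter.2 ⟨List.mem_finRange i', by simpa using h1⟩),
          hlt⟩
      · exact Or.inl (List.mem_filter.2 ⟨List.mem_finRange i', by simpa using h1⟩)

/-- **Clockwise movers**: when `m` (`α < mark m`) moves, exactly the points `i' < m` with
`α < mark i'` are already at their slots. [folklore] -/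
theorem tp_order_cw {k : ℕ} (mark : Fin k → ℝ) (α : ℝ) {m : Fin k} (hm : α < mark m)
    {pre post : List (Fin k)}
    (h : (List.finRange k).filter (fun i => decide (α < mark i)) ++
      ((List.finRange k).filter (fun i => decide (mark i < α))).reverse = pre ++ m :: post) :
    m ∉ pre ∧ ∀ i', i' ≠ m → (i' ∈ pre ↔ α < mark i' ∧ i' < m) := by
  have hm2 : m ∉ ((List.finRange k).filter (fun i => decide (mark i < α))).reverse := by
    intro hmem; have := (List.mem_filter.1 (List.mem_reverse.1 hmem)).2; simp at this; linarith
  obtain ⟨post₁, hl₁⟩ := tp_split_notMem_right hm2 h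
  have hsorted : ((List.finRange k).filter (fun i => decide (α < mark i))).Pairwise (· < ·) :=
    (List.pairwise_lt_finRange k).filter _
  have key := tp_pre_lt hsorted hl₁
  refine ⟨fun hmem => lt_irrefl _ ((key m).1 hmem).2, fun i' hi' => ?_⟩
  rw [key i']
  constructor
  · rintro ⟨h1, h2⟩
    have := (List.mem_filter.1 h1).2
    simp at this
    exact ⟨this, h2⟩
  · rintro ⟨h1, h2⟩
    exact ⟨List.mem_filter.2 ⟨List.mem_finRange i', by simpa using h1⟩, h2⟩

/-! ### Clearance of the marks from the corners -/

/-- **Uniform mark–corner clearance.** [folklore] -/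
theorem tp_mark_corner_dist {k : ℕ} (D : MarkedDomain k) {c : ℤ → ℝ} {a : ℤ → ℕ}
    (hcmono : StrictMono c)
    (hdir : ∀ z, ∀ t ∈ Icc (c z) (c (z + 1)), D.boundary t =
      D.boundary (c z) + ((‖D.boundary t - D.boundary (c z)‖ : ℝ) : ℂ) * Complex.I ^ (a z))
    (hmono : ∀ z, StrictMonoOn (fun t => ‖D.boundary t - D.boundary (c z)‖) (Icc (c z) (c (z + 1))))
    (zm : Fin k → ℤ) (hzm : ∀ i, D.mark i ∈ Ioo (c (zm i)) (c (zm i + 1))) :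
    ∃ dmc : ℝ, 0 < dmc ∧ ∀ i, dmc ≤ ‖D.pt i - D.boundary (c (zm i))‖ ∧
      dmc ≤ ‖D.boundary (c (zm i + 1)) - D.pt i‖ := by
  classical
  set f : Fin k → ℝ := fun i => min ‖D.pt i - D.boundary (c (zm i))‖
    ‖D.boundary (c (zm i + 1)) - D.pt i‖ with hf
  have hfpos : ∀ i, 0 < f i := by
    intro i
    obtain ⟨h1, h2, -⟩ := tp_inside_dist D.toJordanDomain hcmono hdir hmono (zm i) (hzm i)
    exact lt_min h1 h2
  by_cases hne : (Finset.univ : Finset (Fin k)).Nonempty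
  · obtain ⟨i₀, -, hmin⟩ := Finset.univ.exists_min_image f hne
    exact ⟨f i₀, hfpos i₀, fun i => ⟨(hmin i (Finset.mem_univ _)).trans (min_le_left _ _),
      (hmin i (Finset.mem_univ _)).trans (min_le_right _ _)⟩⟩
  · refine ⟨1, one_pos, fun i => absurd ⟨i, Finset.mem_univ i⟩ hne⟩

/-! ### The anchor chart -/

/-- **The anchor chart** (first conclusion of TRANSPORT). On the bottom edge `zA` (`a zA = 0`),
with `an = (⌊re (γ α) / δ⌋, ⌈im (γ (c zA)) / δ⌉)`, within lattice distance `s₀ / δ` of `an` the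
lattice domain is `{v.2 ≥ an.2}`, provided `s₀ + 3 δ ≤` the clearance of `γ α` from the corners
and `s₀ + 2 δ ≤ κ₀`, `3 δ ≤ s₀`. [folklore] -/
theorem tp_anchor_chart {k : ℕ} (D : MarkedDomain k) {M : ℕ} {c : ℤ → ℝ} {a τ : ℤ → ℕ}
    (hM2 : 2 ≤ M) (hcmono : StrictMono c) (hcper : ∀ z, c (z + M) = c z + 1)
    (ha4 : ∀ z, a z < 4) (hτ : ∀ z, τ z = 1 ∨ τ z = 3)
    (hmodτ : ∀ z, (a z + τ z) % 4 = (a (z - 1) + 2) % 4)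
    (hdir : ∀ z, ∀ t ∈ Icc (c z) (c (z + 1)), D.boundary t =
      D.boundary (c z) + ((‖D.boundary t - D.boundary (c z)‖ : ℝ) : ℂ) * Complex.I ^ (a z))
    (hmono : ∀ z, StrictMonoOn (fun t => ‖D.boundary t - D.boundary (c z)‖) (Icc (c z) (c (z + 1))))
    (hflatch : ∀ z, ∀ t ∈ Ioo (c z) (c (z + 1)), ∃ r : ℝ, 0 < r ∧ (∀ w, dist w (D.boundary t) < r
      → (w ∈ frontier D.carrier ↔ (((w - D.boundary t) * (-Complex.I) ^ a z).im = 0 ∧ 0 ≤ ((w -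
      D.boundary t) * (-Complex.I) ^ a z).re) ∨ (((w - D.boundary t) * (-Complex.I) ^ (a z +
      2)).im = 0 ∧ 0 ≤ ((w - D.boundary t) * (-Complex.I) ^ (a z + 2)).re))) ∧ (∀ w, dist w
      (D.boundary t) < r → (w ∈ D.carrier ↔ ((2 = 1 → 0 < ((w - D.boundary t) * (-Complex.I) ^ a
      z).re ∧ 0 < ((w - D.boundary t) * (-Complex.I) ^ a z).im) ∧ (2 = 2 → 0 < ((w - D.boundary t)
      * (-Complex.I) ^ a z).im) ∧ (2 = 3 → 0 < ((w - D.boundary t) * (-Complex.I) ^ a z).im ∨ ((w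
      - D.boundary t) * (-Complex.I) ^ a z).re < 0)))) ∧ (∀ w, dist w (D.boundary t) < r → (w ∈
      closure D.carrier ↔ ((2 = 1 → 0 ≤ ((w - D.boundary t) * (-Complex.I) ^ a z).re ∧ 0 ≤ ((w -
      D.boundary t) * (-Complex.I) ^ a z).im) ∧ (2 = 2 → 0 ≤ ((w - D.boundary t) * (-Complex.I) ^
      a z).im) ∧ (2 = 3 → 0 ≤ ((w - D.boundary t) * (-Complex.I) ^ a z).im ∨ ((w - D.boundary t) *
      (-Complex.I) ^ a z).re ≤ 0)))))
    {κ₀ : ℝ} (hκ₀ : ∀ z z' : ℤ, z + 2 ≤ z' → z' ≤ z + M - 2 →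
      ∀ t ∈ Icc (c z) (c (z + 1)), ∀ t' ∈ Icc (c z') (c (z' + 1)),
        κ₀ ≤ dist (D.boundary t) (D.boundary t'))
    {α : ℝ} {zA : ℤ} (hzA0 : a zA = 0) (hαA : α ∈ Ioo (c zA) (c (zA + 1)))
    {δ s₀ dAc : ℝ} (hδ : 0 < δ) (hδs : 3 * δ ≤ s₀) (hsκ : s₀ + 2 * δ ≤ κ₀) (hsA : s₀ + 3 * δ ≤ dAc)
    (hdAc : dAc ≤ ‖D.boundary α - D.boundary (c zA)‖ ∧ dAc ≤ ‖D.boundary (c (zA + 1)) - D.boundary α‖)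
    {V : Finset (ℤ × ℤ)}
    (hV : ∀ v : ℤ × ℤ, v ∈ V ↔
      ((v.1 : ℂ) * ((δ : ℝ) : ℂ) + (v.2 : ℂ) * ((δ : ℝ) : ℂ) * Complex.I) ∈ closure D.carrier) :
    ∀ v : ℤ × ℤ, ((((v).1 - ⌊(D.boundary α).re / δ⌋) ^ 2 +
      ((v).2 - ⌈(D.boundary (c zA)).im / δ⌉) ^ 2 : ℤ) : ℝ) ≤ (s₀ / δ) ^ 2 →
      (v ∈ V ↔ 0 ≤ v.2 - ⌈(D.boundary (c zA)).im / δ⌉) := by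
  set R' : ℕ := ⌈s₀ / δ⌉₊ with hR'
  have hR'1 : s₀ / δ ≤ R' := Nat.le_ceil _
  have hmar : δ * ((R' : ℝ) + 1) < s₀ + 2 * δ := tp_radius_margin hδ (by linarith)
  have hR'3 : 3 ≤ R' := by
    have : (3 : ℝ) ≤ s₀ / δ := by rw [le_div_iff₀ hδ]; linarith
    exact_mod_cast this.trans hR'1
  -- the anchor edge is horizontal: frame coordinates are `re`, `im`
  set sα := ‖D.boundary α - D.boundary (c zA)‖ with hsα
  have hαre : (D.boundary α).re = (D.boundary (c zA)).re + sα := by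
    have h := hdir zA α ⟨hαA.1.le, hαA.2.le⟩
    rw [hzA0, pow_zero, mul_one] at h
    rw [h, Complex.add_re, Complex.ofReal_re]
  obtain ⟨-, -, hsαℓ⟩ := tp_inside_dist D.toJordanDomain hcmono hdir hmono zA hαA
  change ‖D.boundary (c (zA + 1)) - D.boundary α‖ = ‖D.boundary (c (zA + 1)) - D.boundary (c zA)‖ - sα
    at hsαℓ
  have hfl1 : (D.boundary α).re - δ < δ * ⌊(D.boundary α).re / δ⌋ := by
    have := Int.lt_floor_add_one ((D.boundary α).re / δ)
    rw [div_lt_iff₀ hδ] at this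
    linarith
  have hfl2 : δ * ⌊(D.boundary α).re / δ⌋ ≤ (D.boundary α).re := by
    have := Int.floor_le ((D.boundary α).re / δ)
    rwa [le_div_iff₀ hδ, mul_comm] at this
  have hA0 : (D.boundary (c zA) * (-Complex.I) ^ (a zA)).re = (D.boundary (c zA)).re := by
    rw [hzA0, pow_zero, mul_one]
  have hB0 : (D.boundary (c zA) * (-Complex.I) ^ (a zA)).im = (D.boundary (c zA)).im := by
    rw [hzA0, pow_zero, mul_one]
  obtain ⟨hflat, -⟩ := tp_rail_point D.toJordanDomain hM2 hcmono hcper ha4 hτ hmodτ hdir hmono hflatch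
    hκ₀ hδ hV zA ⌊(D.boundary α).re / δ⌋ R' hR'3 (by linarith)
    (by rw [hA0]; linarith [hdAc.1]) (by rw [hA0]; linarith [hdAc.2, hsαℓ])
  rw [hB0, hzA0, ← tp_slot_point] at hflat
  have h0 : (Fin.ofNat 4 0 : Fin 4) = 0 := rfl
  rw [h0, zero_add, tp_dir_val.2.1] at hflat
  simp only [mul_zero, mul_one, zero_add] at hflat
  intro v hv
  have hs0 : 0 < s₀ := by linarith
  exact hflat v (hv.trans (pow_le_pow_left₀ (by positivity) hR'1 2))

/-- **Registered sub-goal `s7_orderMem` of stub `stub_transportPaths`** (every index occurs in the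
processing order, one-line form of `tp_order_mem`). [folklore] -/
theorem s7_orderMem : ∀ (k : ℕ) (mark : Fin k → ℝ) (α : ℝ), (∀ i, mark i ≠ α) → ∀ (i : Fin k), i ∈ (List.finRange k).filter (fun i => decide (α < mark i)) ++ ((List.finRange k).filter (fun i => decide (mark i < α))).reverse :=
  fun _ mark α hαm i => tp_order_mem mark α hαm i

end Summit.CriticalPhenomena.CardyFormulaZ2.Cruxes.BoundaryDefectGaussianR.RainbowMonomialsInExcursionKernels

end
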